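import Summits.QuantumFields.YangMills.Theses.LangevinControlUV
import Summits.QuantumFields.YangMills.Theses.OneCertifiedCube
import Summits.QuantumFields.YangMills.Theorems.LatticeGapInUVUnits.Negative.WeakCouplingConcentration
import Summits.QuantumFields.YangMills.Theorems.LatticeGapInUVUnits.Negative.UniformConstantFalse
import Literature.MathematicalPhysics.QuantumFieldTheory.TorusFreeTransfer

/-!
# Line `one-ruler` — skeleton for crux `LangevinControlUV.LatticeGapInUVUnits` (stmt-QuantumFields-9366), gen 2

Crux-plan for idea `Cruxes/LatticeGapInUVUnits/Ideas/one-ruler.md` (ideator 2). Panel: TRIAGE-r1-1 fail ("costume at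
the Transfer `OneScale`; harvest the PROVED adapters"), r1-2 pass ("adapter + refutation shape"; T1 thermal remainder),
r1-3 (gen 2) fail ("costume as a stand-alone line; E4 torus adapter; γ: every line presupposes C′"). Gen 1 of this
plan (planner-cruxplan-…-one-ruler-0) answered the panel by removing `OneScale` and wiring in the torus-native engine
`OneCertifiedCube.FiniteSizeCriterion`; gen 2 keeps that architecture and changes the REPAIR the line is built on:
not the line-specific R1 (`MonotoneOn Γ`) but the standing disprover's C′ = `Continuous a` (Disproof §9
`CruxRepaired`, verbatim below), which a new theorem of this file makes sufficient.

**The lever (idea card) and what gen 2 proves about it.** Measure every infrared quantity with the femto ruler the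
hypothesis hands over (`L₀(β) ∝ 1/a(β)`): the crux becomes a FIXED-SCALE-RATIO statement. The card's rigidity
("two femto rulers agree up to constants") needed `MonotoneOn Γ`; gen 1 claimed continuity of `a` alone would need
asymptotic freedom. It does not: `ruler_dominates_of_upper` (§2, PROVED, ~200 lines) dominates every CONTINUOUS package
ruler by any CONTINUOUS ruler carrying merely an UPPER femto bound with vanishing shape, using two tree inputs only —
weak-coupling concentration (landed `Negative.tendsto_cov_plaquetteCost`, Disproof §6) and continuity of
`β ↦ E_{β,L}[F]` (`continuous_wilsonExpectation_beta`, §1, PROVED by dominated convergence) — plus the intermediate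
value theorem twice (FLOOR: the package pins `c'Γ₂ ≥ η > 0` on the femto-edge interval through a compact set of
couplings; CEILING: `Γ₁(x) < θ` for ALL small `x`, not only on the grid `x = a₁(β)`). Corollaries:
`rulerRigidity_continuous` (the C′ socket is CANONICAL), `femtoWindowFrom_transfer` (the physics certificate does not
depend on the continuous femto ruler it is stated in: `femtoWindowStub_iff_exists`), `femtoWindowFrom_of_upperRuler`
(to serve an abstract ruler it suffices to certify in ONE explicit ruler with a perturbative UPPER bound — no lower
bound, no package for the explicit ruler: `femtoWindow_of_uvRuler`, the foreseen UV/IR split of the physics stub).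

**The three registered stubs** (`lean check` rc 0; sorries ONLY here):
* S0 `stub_rulerReduction : RulerReduction` — the TYPED-DEFECT SOCKET, VERBATIM the sibling line's
  `KnabeBlockSampler.RulerReduction` (one socket, one repair for both lines of this crux): every package ruler is
  eventually dominated by a CONTINUOUS package ruler. Identity on continuous rulers (`rulerReduction_of_continuous`);
  physically false for the slow STEP rulers of the Disproof's PAPER KILL exactly as the crux is (`not_crux_of_slow_ruler`,
  §6). DO NOT STAFF; moot once 9366 is restated as C′ (`cruxRepaired_of` needs no S0).
* S1 `stub_femtoWindow : FemtoWindowStub` — THE PHYSICS (hardest, open): for every compact simple `G`, faithful `r` and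
  CONTINUOUS package ruler `a`, ONE `(Θ₀, n, ε)` with the universal threshold `εM(n) < 1` and TV finite-size windows of
  the Wilson specification at every `β ≥ β⋆` and EVERY cell `b ≥ Θ₀/a(β)` (`FemtoWindowFrom`). Different in kind from
  the crux (finite volume, one functional, strong mixing uniform in boundary data vs. all pairs / all volumes / a rate).
* S2 `stub_finiteSizeCriterion : OneCertifiedCube.FiniteSizeCriterion` — THE ENGINE = item stmt-QuantumFields-8895 BY
  NAME (TV finite-size condition at one cell ⇒ `C(A,B)e^{−κt/b}` on EVERY symmetric torus `2S+1 ≥ (8n+7)b`; torus-native: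
  no transfer matrix, so the thermal-remainder stub T1/E4 of the panel never arises; per-pair constants, as the landed
  `Negative.not_uniform_constant_clustering_of_simple` says they must be).

**Composition** (`stubsImplyCrux`, kernel-checked, axioms {propext, Classical.choice, Quot.sound}; `LatticeGapInUVUnits_of`
concludes the crux BY NAME): `Package r a` →(S0) continuous `a'` with `Package`, `a ≤ K₀a'` eventually →(S1)
`FemtoWindowFrom r a'` → certificate at cell `⌈Θ₀/a'(β)⌉` →(S2 + `concl_of_window`: `c₁ = κ/(2Θ₀)`,
`S₁(β) = (8n+7)⌈Θ₀/a'(β)⌉`, `C(A,B) = max C 0`) `Concl r a'` →(`concl_of_dominated`) `Concl r a`. Rigidity is not on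
this path — it is what makes S1 well-posed (ruler-independent) and reducible to one explicit ruler.

**Disproof.lean v5 (cdisprove gen 1, 01:47Z) used.** No `_false_without_<H>` theorem exists (verdict: no formal kill;
MISSTATED ON PAPER; C′ = `Continuous a`). §0 anatomy copied verbatim (`BoxBounds/PackageWith/Package/Concl`, `crux_iff`;
the crux-dir module is not importable); §9 `CruxRepaired` copied VERBATIM and PROVED from S1+S2 (`cruxRepaired_of`) —
the line is a line for C′ and the typed residue is exactly S0; §1 `concl_of_eventually_le` + §2 `concl_smul_iff` =
`concl_of_dominated` (H = domination by a continuous ruler, used at S0); §4 `a → 0` load-bearing — used in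
`concl_of_window` (`a ≤ Θ` eventually) and in both IVT steps of rigidity; §5 germ — all thresholds pushed up freely;
§6 `packageWith_shape_tendsto_zero` re-proved from the LANDED `Negative/WeakCouplingConcentration.lean` (p73970) and used
as the CEILING input of rigidity, `not_packageWith_of_shape_ge` re-derived; §7 / LANDED `Negative/UniformConstantFalse.lean`
(p74453) imported and instantiated (§6 `example`): every `Concl` here is per pair. No stub is an instance of a landed
Negative lemma (they refute: shapes bounded below, subsingleton packages, uniform `C`).
-/

set_option autoImplicit false

noncomputable section

namespace Summit.QuantumFields.YangMills.Cruxes.LatticeGapInUVUnits.OneRuler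

open Filter Topology MeasureTheory
open Literature.MathematicalPhysics.QuantumFieldTheory Literature.MathematicalPhysics.QuantumLattice
open Summit.QuantumFields.YangMills.Theses.LangevinControlUV
open Summit.QuantumFields.YangMills.Theorems.LatticeGapInUVUnits.Negative
  (tendsto_cov_plaquetteCost zero_lt_one_fin4 not_uniform_constant_clustering_of_simple)

/-! ## §0 Anatomy of the crux (verbatim Disproof.lean §0) and the repaired crux C′ (verbatim Disproof §9) -/

section Anatomy

variable {G : Type} [Group G] [TopologicalSpace G] [IsTopologicalGroup G] [CompactSpace G]
  [MeasurableSpace G] [BorelSpace G]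

/-- Femto two-point bounds in ONE periodic box `(ℤ/L)⁴` at coupling `β` (verbatim the `let`-body shared by the four
cruxes of route `LangevinControlUV`; = Disproof §0 `BoxBounds`). -/
def BoxBounds (r : LatticeRep G) (a Γ : ℝ → ℝ) (c C : ℝ) (L : ℕ) [NeZero L] (β : ℝ) : Prop :=
  let P : (Fin 4 → ZMod L) → Fin 4 → Fin 4 → GaugeConfig 4 L G → ℝ :=
    fun x i j U => (r.N : ℝ) - (r.ρ (plaquetteHolonomy U x i j)).trace.re
  let E : (GaugeConfig 4 L G → ℝ) → ℝ := fun F => wilsonExpectation (d := 4) (L := L) r.ρ β F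
  let cov : (GaugeConfig 4 L G → ℝ) → (GaugeConfig 4 L G → ℝ) → ℝ :=
    fun F F' => E (fun U => F U * F' U) - E F * E F'
  let dist : (Fin 4 → ZMod L) → (Fin 4 → ZMod L) → ℝ :=
    fun x y => Real.sqrt (∑ k : Fin 4, (((x k - y k).valMinAbs : ℤ) : ℝ) ^ 2)
  (∀ n : ℕ, 1 ≤ n → 8 * n ≤ L →
      c * Γ ((n : ℝ) * a β) ≤ (n : ℝ) ^ 8 * cov (P 0 0 1) (P (Pi.single (2 : Fin 4) ((n : ℕ) : ZMod L)) 0 1) ∧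
        (n : ℝ) ^ 8 * cov (P 0 0 1) (P (Pi.single (2 : Fin 4) ((n : ℕ) : ZMod L)) 0 1) ≤ C * Γ ((n : ℝ) * a β)) ∧
    (∀ (x y : Fin 4 → ZMod L) (i j i' j' : Fin 4), x ≠ y → i ≠ j → i' ≠ j' →
      |cov (P x i j) (P y i' j')| * dist x y ^ 8 ≤ C * Γ (dist x y * a β))

/-- The femto two-point PACKAGE of the unit map `a` with explicit witnesses (= Disproof §0 `PackageWith`). -/
def PackageWith (r : LatticeRep G) (a Γ : ℝ → ℝ) (β₀ ℓ₀ c C : ℝ) : Prop :=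
  0 < ℓ₀ ∧ 0 < c ∧ (∀ β, 0 < a β) ∧ Tendsto a atTop (𝓝 0) ∧
    (∀ s : ℝ, 0 < s → s ≤ ℓ₀ → 0 < Γ s ∧ Γ s ≤ 1) ∧
      ∀ (L : ℕ) [NeZero L] (β : ℝ), β₀ ≤ β → (L : ℝ) * a β ≤ ℓ₀ → BoxBounds r a Γ c C L β

/-- The hypothesis of the crux on the unit map `a` (= Disproof §0 `Package`). -/
def Package (r : LatticeRep G) (a : ℝ → ℝ) : Prop :=
  ∃ (Γ : ℝ → ℝ) (β₀ ℓ₀ c C : ℝ), PackageWith r a Γ β₀ ℓ₀ c C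

/-- The conclusion of the crux: volume-uniform clustering of all pairs at SOME rate `c₁ · a(β)`, per-pair constants
(= Disproof §0 `Concl`). -/
def Concl (r : LatticeRep G) (a : ℝ → ℝ) : Prop :=
  ∃ (c₁ β₂ : ℝ) (S₁ : ℝ → ℕ), 0 < c₁ ∧ ∀ A B : YMSpecies G, ∃ C : ℝ, ∀ β : ℝ, β₂ ≤ β → ∀ S n : ℕ,
    S₁ β ≤ S → n ≤ S → |latticeConnectedCorr r.ρ β (2 * S + 1) A.F B.F n| ≤ C * Real.exp (-(c₁ * a β * n))

/-- Shrinking the femto range `ℓ₀` preserves a package (fewer boxes, shape constraints on a sub-interval). -/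
theorem packageWith_mono_ell (r : LatticeRep G) {a Γ : ℝ → ℝ} {β₀ ℓ₀ c C : ℝ}
    (h : PackageWith r a Γ β₀ ℓ₀ c C) {ℓ₁ : ℝ} (hℓ₁ : 0 < ℓ₁) (hle : ℓ₁ ≤ ℓ₀) :
    PackageWith r a Γ β₀ ℓ₁ c C := by
  obtain ⟨-, hc, hpos, hlim, hΓ, hbox⟩ := h
  exact ⟨hℓ₁, hc, hpos, hlim, fun s hs hsl => hΓ s hs (hsl.trans hle),
    fun L _ β hβ hL => hbox L β hβ (hL.trans hle)⟩

/-- **One-sided (UPPER) femto bound of a ruler with a shape vanishing along it** — the half of a package that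
`ruler_dominates_of_upper` needs from the DOMINATING ruler: the axis upper bound `n⁸·Cov ≤ C·Γ(n a(β))` in femto
boxes, `Γ ≥ 0`, and `Γ(a(β)) → 0`. Every package gives one (`upperFemtoBound_of_packageWith`, the vanishing being
Disproof §6); an EXPLICIT perturbative ruler (two-loop `a_phys`, a step-scaling unit, Bałaban's `M^{−j(β)}`) with a
tree-level-plus-asymptotic-freedom upper bound gives one WITHOUT any lower bound — this is how the prover of
`stub_femtoWindow` may move to an explicit ruler (`femtoWindow_of_uvRuler`). -/
def UpperFemtoBound (r : LatticeRep G) (a Γ : ℝ → ℝ) (β₀ ℓ₀ C : ℝ) : Prop :=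
  0 < ℓ₀ ∧ (∀ β, 0 < a β) ∧ Tendsto a atTop (𝓝 0) ∧ (∀ s : ℝ, 0 < s → s ≤ ℓ₀ → 0 ≤ Γ s) ∧
    Tendsto (fun β => Γ (a β)) atTop (𝓝 0) ∧
      ∀ (L : ℕ) [NeZero L] (β : ℝ), β₀ ≤ β → (L : ℝ) * a β ≤ ℓ₀ →
        let P : (Fin 4 → ZMod L) → Fin 4 → Fin 4 → GaugeConfig 4 L G → ℝ :=
          fun x i j U => (r.N : ℝ) - (r.ρ (plaquetteHolonomy U x i j)).trace.re
        let E : (GaugeConfig 4 L G → ℝ) → ℝ := fun F => wilsonExpectation (d := 4) (L := L) r.ρ β F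
        let cov : (GaugeConfig 4 L G → ℝ) → (GaugeConfig 4 L G → ℝ) → ℝ :=
          fun F F' => E (fun U => F U * F' U) - E F * E F'
        ∀ n : ℕ, 1 ≤ n → 8 * n ≤ L →
          (n : ℝ) ^ 8 * cov (P 0 0 1) (P (Pi.single (2 : Fin 4) ((n : ℕ) : ZMod L)) 0 1) ≤ C * Γ ((n : ℝ) * a β)

end Anatomy

/-- **The crux uncurried** (as Disproof §0 `crux_iff`): `LatticeGapInUVUnits` is literally
`∀ G (compact simple) r a, Package r a → Concl r a`. -/
theorem crux_iff :
    LatticeGapInUVUnits ↔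
      ∀ (G : Type) [Group G] [TopologicalSpace G] [IsTopologicalGroup G] [CompactSpace G],
        IsCompactSimpleLieGroup G →
          letI : MeasurableSpace G := borel G
          haveI : BorelSpace G := ⟨rfl⟩
          ∀ (r : LatticeRep G) (a : ℝ → ℝ), Package r a → Concl r a := by
  constructor
  · intro h G _ _ _ _ hG r a hP
    obtain ⟨Γ, β₀, ℓ₀, c, C, hℓ, hc, hpos, hlim, hΓ, hbox⟩ := hP
    exact h G hG r a ⟨Γ, β₀, ℓ₀, c, C, hℓ, hc, hpos, hlim, hΓ, fun L _ β h₁ h₂ => hbox L β h₁ h₂⟩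
  · intro h G _ _ _ _ hG r a hP
    obtain ⟨Γ, β₀, ℓ₀, c, C, hℓ, hc, hpos, hlim, hΓ, hbox⟩ := hP
    exact h G hG r a ⟨Γ, β₀, ℓ₀, c, C, hℓ, hc, hpos, hlim, hΓ, fun L _ β h₁ h₂ => hbox L β h₁ h₂⟩

/-- **The repaired crux C′** (VERBATIM `Disproof.CruxRepaired`, the standing disprover's repair; classification
`refuted-misstated` if a kill ever lands): the crux restricted to CONTINUOUS unit maps. This file proves C′ from the
physics stub and the engine alone (`cruxRepaired_of`, §5) — the socket stub `stub_rulerReduction` drops out. -/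
def CruxRepaired : Prop :=
  ∀ (G : Type) [Group G] [TopologicalSpace G] [IsTopologicalGroup G] [CompactSpace G],
    IsCompactSimpleLieGroup G →
      letI : MeasurableSpace G := borel G
      haveI : BorelSpace G := ⟨rfl⟩
      ∀ (r : LatticeRep G) (a : ℝ → ℝ), Continuous a → Package r a → Concl r a

/-- C′ is implied by the crux as filed (it only removes unit maps from the `∀`). -/
theorem cruxRepaired_of_crux (h : LatticeGapInUVUnits) : CruxRepaired := by
  rw [crux_iff] at h
  intro G _ _ _ _ hG r a _ hP
  exact h G hG r a hP

/-! ## §1 Two analytic inputs from the tree: weak-coupling concentration (landed Negative lemma) and continuity in `β` -/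

section Analytic

variable {G : Type} [Group G] [TopologicalSpace G] [IsTopologicalGroup G] [CompactSpace G]
  [MeasurableSpace G] [BorelSpace G]

/-- The axis covariance `Cov_{β,8}(P₀^{01}, P_{e₂}^{01})` of the `8⁴` torus (box `L = 8`, separation `n = 1` of the
package), as a function of the coupling. -/
def cov8 (r : LatticeRep G) (β : ℝ) : ℝ :=
  wilsonExpectation (d := 4) (L := 8) r.ρ β (fun U => ((r.N : ℝ) - (r.ρ (plaquetteHolonomy U 0 0 1)).trace.re) *
      ((r.N : ℝ) - (r.ρ (plaquetteHolonomy U (Pi.single (2 : Fin 4) ((1 : ℕ) : ZMod 8)) 0 1)).trace.re)) -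
    wilsonExpectation (d := 4) (L := 8) r.ρ β (fun U => (r.N : ℝ) - (r.ρ (plaquetteHolonomy U 0 0 1)).trace.re) *
      wilsonExpectation (d := 4) (L := 8) r.ρ β
        (fun U => (r.N : ℝ) - (r.ρ (plaquetteHolonomy U (Pi.single (2 : Fin 4) ((1 : ℕ) : ZMod 8)) 0 1)).trace.re)

/-- `Cov_{β,8}(P₀^{01}, P_{e₂}^{01}) → 0` as `β → ∞` (the landed `Negative.tendsto_cov_plaquetteCost`). -/
theorem tendsto_cov8 (r : LatticeRep G) : Tendsto (cov8 r) atTop (𝓝 0) :=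
  tendsto_cov_plaquetteCost r 8 ((0 : Site 4 8), ⟨(0, 1), zero_lt_one_fin4⟩)
    ((Pi.single (2 : Fin 4) ((1 : ℕ) : ZMod 8) : Site 4 8), ⟨(0, 1), zero_lt_one_fin4⟩)

/-- **The shape function of ANY femto package vanishes along its unit map**: `Γ(a(β)) → 0` (box `L = 8`, `n = 1`:
`c Γ(a(β)) ≤ Cov_{β,8} → 0`). This is Disproof §6 `packageWith_shape_tendsto_zero`, re-proved against the landed
`Negative/WeakCouplingConcentration.lean` so that rigidity below has NO unlanded input. -/
theorem packageWith_shape_tendsto_zero (r : LatticeRep G) {a Γ : ℝ → ℝ} {β₀ ℓ₀ c C : ℝ}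
    (h : PackageWith r a Γ β₀ ℓ₀ c C) : Tendsto (fun β => Γ (a β)) atTop (𝓝 0) := by
  obtain ⟨hℓ, hc, hpos, hlim, hΓ, hbox⟩ := h
  have hev : ∀ᶠ β in atTop, a β < ℓ₀ / 8 := hlim (Iio_mem_nhds (by positivity))
  have hkey : ∀ᶠ β in atTop, 0 ≤ Γ (a β) ∧ Γ (a β) ≤ cov8 r β / c := by
    filter_upwards [hev, eventually_ge_atTop β₀] with β hβ hβ₀
    have hB : BoxBounds r a Γ c C 8 β := hbox 8 β hβ₀ (by push_cast; linarith)
    obtain ⟨hax, -⟩ := hB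
    have h1 : c * Γ (((1 : ℕ) : ℝ) * a β) ≤ ((1 : ℕ) : ℝ) ^ 8 * cov8 r β := (hax 1 le_rfl (by norm_num)).1
    simp only [Nat.cast_one, one_mul, one_pow] at h1
    have hΓ' := hΓ (a β) (hpos β) (by linarith)
    refine ⟨hΓ'.1.le, ?_⟩
    rw [le_div_iff₀ hc]
    linarith
  refine tendsto_of_tendsto_of_tendsto_of_le_of_le' tendsto_const_nhds ?_
    (hkey.mono fun β h => h.1) (hkey.mono fun β h => h.2)
  simpa using (tendsto_cov8 r).div_const c

/-- Every package is in particular an upper femto bound with vanishing shape. -/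
theorem upperFemtoBound_of_packageWith (r : LatticeRep G) {a Γ : ℝ → ℝ} {β₀ ℓ₀ c C : ℝ}
    (h : PackageWith r a Γ β₀ ℓ₀ c C) : UpperFemtoBound r a Γ β₀ ℓ₀ C := by
  have hv := packageWith_shape_tendsto_zero r h
  obtain ⟨hℓ, -, hpos, hlim, hΓ, hbox⟩ := h
  refine ⟨hℓ, hpos, hlim, fun s hs hsl => (hΓ s hs hsl).1.le, hv, fun L _ β hβ hL => ?_⟩
  obtain ⟨hax, -⟩ := hbox L β hβ hL
  exact fun n hn h8 => (hax n hn h8).2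

/-- **Continuity in the coupling.** On a fixed torus the Wilson expectation of a continuous observable is a continuous
function of `β` (ratio of two product-Haar integrals of `F e^{−βS}`, `e^{−βS}`, each continuous in `β` by dominated
convergence; the denominator is positive). The second analytic input of rigidity for CONTINUOUS rulers. -/
theorem continuous_wilsonExpectation_beta (r : LatticeRep G) (L : ℕ) [NeZero L]
    {F : GaugeConfig 4 L G → ℝ} (hF : Continuous F) :
    Continuous fun β : ℝ => wilsonExpectation (d := 4) (L := L) r.ρ β F := by
  haveI : SecondCountableTopology G :=
    (r.continuous.isClosedEmbedding r.injective).isEmbedding.secondCountableTopology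
  set π : Measure (GaugeConfig 4 L G) := Measure.pi fun _ : Edge 4 L => haarProbability G with hπ
  have hS : Continuous (wilsonAction (d := 4) (L := L) r.ρ : GaugeConfig 4 L G → ℝ) :=
    Literature.Barriers.QuantumFields.Elitzur.continuous_wilsonAction r.ρ r.continuous
  obtain ⟨B, hB⟩ := exists_abs_wilsonAction_le (d := 4) (L := L) r.ρ r.continuous
  have hB0 : 0 ≤ B := (abs_nonneg _).trans (hB 1)
  -- weighted product-Haar integrals of bounded continuous observables are continuous in `β`
  have hcont : ∀ (Φ : GaugeConfig 4 L G → ℝ), Continuous Φ → ∀ MΦ : ℝ, (∀ U, |Φ U| ≤ MΦ) →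
      Continuous fun β : ℝ => ∫ U, Φ U * Real.exp (-β * wilsonAction r.ρ U) ∂π := by
    intro Φ hΦ MΦ hMΦ
    refine continuous_iff_continuousAt.2 fun β₀ => ?_
    refine continuousAt_of_dominated (bound := fun _ => |MΦ| * Real.exp ((|β₀| + 1) * B)) ?_ ?_ ?_ ?_
    · exact Eventually.of_forall fun β =>
        (hΦ.mul (Real.continuous_exp.comp (continuous_const.mul hS))).aestronglyMeasurable
    · filter_upwards [Metric.ball_mem_nhds β₀ one_pos] with β hβ
      refine Eventually.of_forall fun U => ?_
      rw [Real.norm_eq_abs, abs_mul, Real.abs_exp]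
      have hβ' : |β - β₀| < 1 := by rwa [Metric.mem_ball, Real.dist_eq] at hβ
      have h2 : |β| ≤ |β₀| + 1 := by
        have := abs_sub_abs_le_abs_sub β β₀
        linarith
      have h1 : -β * wilsonAction r.ρ U ≤ |β| * B :=
        calc -β * wilsonAction r.ρ U ≤ |-β * wilsonAction r.ρ U| := le_abs_self _
          _ = |β| * |wilsonAction r.ρ U| := by rw [abs_mul, abs_neg]
          _ ≤ |β| * B := mul_le_mul_of_nonneg_left (hB U) (abs_nonneg _)
      exact mul_le_mul ((hMΦ U).trans (le_abs_self _))
        (Real.exp_le_exp.2 (h1.trans (mul_le_mul_of_nonneg_right h2 hB0))) (Real.exp_pos _).le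
        (abs_nonneg _)
    · exact integrable_const _
    · exact Eventually.of_forall fun U =>
        (continuous_const.mul (Real.continuous_exp.comp (continuous_neg.mul continuous_const))).continuousAt
  obtain ⟨M, hM⟩ : ∃ M : ℝ, ∀ U, |F U| ≤ M := by
    obtain ⟨M, hM⟩ := isCompact_univ.exists_bound_of_continuousOn hF.continuousOn
    exact ⟨M, fun U => by simpa [Real.norm_eq_abs] using hM U (Set.mem_univ U)⟩
  have hN := hcont F hF M hM
  have hZ : Continuous fun β : ℝ => ∫ U, Real.exp (-β * wilsonAction r.ρ U) ∂π := by
    have := hcont (fun _ => (1 : ℝ)) continuous_const 1 (fun _ => by simp)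
    simpa using this
  have hZpos : ∀ β : ℝ, 0 < ∫ U, Real.exp (-β * wilsonAction r.ρ U) ∂π := fun β => by
    haveI : NeZero π := ⟨IsProbabilityMeasure.ne_zero π⟩
    exact integral_exp_pos
      ((Real.continuous_exp.comp (continuous_const.mul hS)).integrable_of_hasCompactSupport
        (HasCompactSupport.of_compactSpace _))
  have heq : (fun β : ℝ => wilsonExpectation (d := 4) (L := L) r.ρ β F) = fun β =>
      (∫ U, F U * Real.exp (-β * wilsonAction r.ρ U) ∂π) /
        ∫ U, Real.exp (-β * wilsonAction r.ρ U) ∂π := by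
    funext β
    exact wilsonExpectation_eq_div_integral (d := 4) r.ρ r.continuous β F
  rw [heq]
  exact hN.div hZ fun β => (hZpos β).ne'

/-- The box-`8` axis covariance is continuous in the coupling. -/
theorem continuous_cov8 (r : LatticeRep G) : Continuous (cov8 r) := by
  have hP : ∀ (x : Site 4 8) (i j : Fin 4),
      Continuous fun U : GaugeConfig 4 8 G => (r.N : ℝ) - (r.ρ (plaquetteHolonomy U x i j)).trace.re := by
    intro x i j
    have h1 : Continuous fun U : GaugeConfig 4 8 G => plaquetteHolonomy U x i j := by
      unfold plaquetteHolonomy; fun_prop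
    exact continuous_const.sub (Complex.continuous_re.comp (r.continuous.comp h1).matrix_trace)
  unfold cov8
  exact (continuous_wilsonExpectation_beta r 8 ((hP 0 0 1).mul (hP _ 0 1))).sub
    ((continuous_wilsonExpectation_beta r 8 (hP 0 0 1)).mul (continuous_wilsonExpectation_beta r 8 (hP _ 0 1)))

end Analytic

/-! ## §2 Ruler rigidity: continuous femto rulers agree up to constants (PROVED; no monotonicity, no physics) -/

section Rigidity

variable {G : Type} [Group G] [TopologicalSpace G] [IsTopologicalGroup G] [CompactSpace G]
  [MeasurableSpace G] [BorelSpace G]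

/-- **One-sided ruler domination from an UPPER bound.** Let `a₁` be a CONTINUOUS ruler with an upper femto bound whose
shape vanishes along it, and `a₂` a CONTINUOUS ruler carrying a full package. Then `a₂ ≤ K · a₁` eventually.
Proof (order bookkeeping + two tree inputs). Shrink ruler 2's range to `ℓ₁ = min ℓ₀' (8 a₂ β₀')`. FLOOR: on the edge
interval `s ∈ [ℓ₁/16, ℓ₁/8]` the package pins `c'Γ₂(s) ≥ η > 0` — by the intermediate value theorem `s = a₂(β')` for some
`β'` in the COMPACT set `K = {β' ≥ β₀' : a₂ β' ∈ [ℓ₁/16, ℓ₁/8]}`, where the box-`8` upper bound gives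
`C'Γ₂(a₂ β') ≥ Cov_{β',8}`, a continuous (`continuous_cov8`) positive function, hence bounded below on `K`. CEILING: by
`Γ₁(a₁ β') → 0` and the intermediate value theorem for `a₁`, `Γ₁(x) < θ := η / max C 1` for ALL `0 < x ≤ α := a₁ β₄`.
COMPARISON at the femto edge of ruler 2 (`L = ⌊ℓ₁/a₂ β⌋`, `n = L/8`): either the box is not femto for ruler 1
(`a₂ β < (ℓ₁/ℓ₀) a₁ β`), or `η ≤ c'Γ₂(n a₂ β) ≤ n⁸Cov ≤ C Γ₁(n a₁ β)` forces `n a₁ β > α`, i.e.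
`a₂ β ≤ ℓ₁/(8α) · a₁ β`. -/
theorem ruler_dominates_of_upper (r : LatticeRep G) {a₁ a₂ Γ₁ Γ₂ : ℝ → ℝ} {β₀ ℓ₀ C β₀' ℓ₀' c' C' : ℝ}
    (h₁ : UpperFemtoBound r a₁ Γ₁ β₀ ℓ₀ C) (ha₁ : Continuous a₁)
    (h₂ : PackageWith r a₂ Γ₂ β₀' ℓ₀' c' C') (ha₂ : Continuous a₂) :
    ∃ K β₃ : ℝ, 0 < K ∧ ∀ β, β₃ ≤ β → a₂ β ≤ K * a₁ β := by
  obtain ⟨hℓ, hpos₁, hlim₁, hΓ₁, hv₁, hbox₁⟩ := h₁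
  have hℓ' : 0 < ℓ₀' := h₂.1
  have hc' : 0 < c' := h₂.2.1
  have hpos₂ : ∀ β, 0 < a₂ β := h₂.2.2.1
  have hlim₂ : Tendsto a₂ atTop (𝓝 0) := h₂.2.2.2.1
  -- shrink the femto range of ruler 2 so that its first coupling sees the whole edge interval
  set ℓ₁ : ℝ := min ℓ₀' (8 * a₂ β₀') with hℓ₁def
  have hℓ₁pos : 0 < ℓ₁ := lt_min hℓ' (by linarith [hpos₂ β₀'])
  have hℓ₁le : ℓ₁ ≤ ℓ₀' := min_le_left _ _
  have hℓ₁le' : ℓ₁ ≤ 8 * a₂ β₀' := min_le_right _ _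
  obtain ⟨-, -, -, -, hΓ₂, hbox₂⟩ := packageWith_mono_ell r h₂ hℓ₁pos hℓ₁le
  -- FLOOR. The compact set of couplings at which ruler 2 sits in the edge interval
  set Kset : Set ℝ := Set.Ici β₀' ∩ a₂ ⁻¹' Set.Icc (ℓ₁ / 16) (ℓ₁ / 8) with hKdef
  obtain ⟨B₂, hB₂⟩ := Filter.eventually_atTop.1 (hlim₂ (Iio_mem_nhds (show (0 : ℝ) < ℓ₁ / 16 by positivity)))
  have hKsub : Kset ⊆ Set.Icc β₀' B₂ := by
    intro β' hβ'
    refine ⟨hβ'.1, ?_⟩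
    by_contra hlt
    push Not at hlt
    have h1 : a₂ β' < ℓ₁ / 16 := hB₂ β' hlt.le
    have h2 : ℓ₁ / 16 ≤ a₂ β' := hβ'.2.1
    linarith
  have hKclosed : IsClosed Kset := isClosed_Ici.inter (isClosed_Icc.preimage ha₂)
  have hKcpt : IsCompact Kset := isCompact_Icc.of_isClosed_subset hKclosed hKsub
  -- every level of the edge interval is attained inside `Kset` (intermediate value theorem)
  have hIVT : ∀ s : ℝ, ℓ₁ / 16 ≤ s → s ≤ ℓ₁ / 8 → ∃ β' ∈ Kset, a₂ β' = s := by
    intro s hslo hshi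
    have hspos : 0 < s := lt_of_lt_of_le (by positivity) hslo
    obtain ⟨B, hB⟩ := Filter.eventually_atTop.1 (hlim₂ (Iio_mem_nhds hspos))
    have htop : s ≤ a₂ β₀' := by linarith
    have hbot : a₂ (max β₀' B) < s := hB _ (le_max_right _ _)
    have hmem : s ∈ Set.Icc (a₂ (max β₀' B)) (a₂ β₀') := ⟨hbot.le, htop⟩
    obtain ⟨β', hβ'I, hβ's⟩ := intermediate_value_Icc' (le_max_left β₀' B) ha₂.continuousOn hmem
    exact ⟨β', ⟨hβ'I.1, by rw [Set.mem_preimage, hβ's]; exact ⟨hslo, hshi⟩⟩, hβ's⟩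
  have hKne : Kset.Nonempty := by
    obtain ⟨β', hβ', -⟩ := hIVT (ℓ₁ / 8) (by linarith) le_rfl
    exact ⟨β', hβ'⟩
  -- the box-`8` bounds on `Kset`
  have hcovK : ∀ β' ∈ Kset, c' * Γ₂ (a₂ β') ≤ cov8 r β' ∧ cov8 r β' ≤ C' * Γ₂ (a₂ β') := by
    intro β' hβ'
    have h8 : ((8 : ℕ) : ℝ) * a₂ β' ≤ ℓ₁ := by push_cast; linarith [hβ'.2.2]
    obtain ⟨hax, -⟩ := hbox₂ 8 β' hβ'.1 h8
    have h1 : c' * Γ₂ (((1 : ℕ) : ℝ) * a₂ β') ≤ ((1 : ℕ) : ℝ) ^ 8 * cov8 r β' ∧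
        ((1 : ℕ) : ℝ) ^ 8 * cov8 r β' ≤ C' * Γ₂ (((1 : ℕ) : ℝ) * a₂ β') := hax 1 le_rfl (by norm_num)
    simp only [Nat.cast_one, one_mul, one_pow] at h1
    exact h1
  obtain ⟨βm, hβmK, hβmin⟩ := hKcpt.exists_isMinOn hKne (continuous_cov8 r).continuousOn
  set m₀ : ℝ := cov8 r βm with hm₀def
  have hΓ₂m : 0 < Γ₂ (a₂ βm) := (hΓ₂ (a₂ βm) (hpos₂ βm) (by linarith [hβmK.2.2])).1
  have hm₀pos : 0 < m₀ := lt_of_lt_of_le (mul_pos hc' hΓ₂m) (hcovK βm hβmK).1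
  have hC'pos : 0 < C' := by
    have h := (hcovK βm hβmK).2
    by_contra hle
    push Not at hle
    have : C' * Γ₂ (a₂ βm) ≤ 0 := mul_nonpos_of_nonpos_of_nonneg hle hΓ₂m.le
    linarith
  set η : ℝ := c' * m₀ / C' with hηdef
  have hη : 0 < η := by positivity
  have hΓ₂floor : ∀ s : ℝ, ℓ₁ / 16 ≤ s → s ≤ ℓ₁ / 8 → η ≤ c' * Γ₂ s := by
    intro s hlo hhi
    obtain ⟨β', hβ'K, hβ's⟩ := hIVT s hlo hhi
    have hup : cov8 r β' ≤ C' * Γ₂ (a₂ β') := (hcovK β' hβ'K).2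
    have hmin : m₀ ≤ cov8 r β' := (isMinOn_iff.1 hβmin) β' hβ'K
    rw [hβ's] at hup
    have hq : m₀ / C' ≤ Γ₂ s := by
      rw [div_le_iff₀ hC'pos]
      linarith
    calc η = c' * (m₀ / C') := by rw [hηdef]; ring
      _ ≤ c' * Γ₂ s := mul_le_mul_of_nonneg_left hq hc'.le
  -- CEILING. A fixed level `α` below which the shape of ruler 1 stays under `θ`
  set Cb : ℝ := max C 1 with hCbdef
  have hCb : 0 < Cb := lt_of_lt_of_le one_pos (le_max_right C 1)
  set θ : ℝ := η / Cb with hθdef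
  have hθ : 0 < θ := div_pos hη hCb
  obtain ⟨β₄, hβ₄⟩ := Filter.eventually_atTop.1 ((tendsto_order.1 hv₁).2 θ hθ)
  set α : ℝ := a₁ β₄ with hαdef
  have hα : 0 < α := hpos₁ β₄
  have hsmall : ∀ x : ℝ, 0 < x → x ≤ α → Γ₁ x < θ := by
    intro x hx hxα
    obtain ⟨B, hB⟩ := Filter.eventually_atTop.1 (hlim₁ (Iio_mem_nhds hx))
    have hbot : a₁ (max β₄ B) < x := hB _ (le_max_right _ _)
    have hmem : x ∈ Set.Icc (a₁ (max β₄ B)) (a₁ β₄) := ⟨hbot.le, hxα⟩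
    obtain ⟨β', hβ'I, hβ'x⟩ := intermediate_value_Icc' (le_max_left β₄ B) ha₁.continuousOn hmem
    rw [← hβ'x]
    exact hβ₄ β' hβ'I.1
  -- threshold `β₃`
  have hev₂ : ∀ᶠ β in atTop, a₂ β ≤ ℓ₁ / 18 := hlim₂ (Iic_mem_nhds (by positivity))
  obtain ⟨β₅, hβ₅⟩ := Filter.eventually_atTop.1
    (hev₂.and ((eventually_ge_atTop β₀).and (eventually_ge_atTop β₀')))
  refine ⟨max (ℓ₁ / ℓ₀) (ℓ₁ / (8 * α)), β₅, lt_max_of_lt_left (div_pos hℓ₁pos hℓ), fun β hβ => ?_⟩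
  obtain ⟨ha₂, hb₀, hb₀'⟩ := hβ₅ β hβ
  have ha₁pos : 0 < a₁ β := hpos₁ β
  have ha₂pos : 0 < a₂ β := hpos₂ β
  have hK₁ : ℓ₁ / ℓ₀ ≤ max (ℓ₁ / ℓ₀) (ℓ₁ / (8 * α)) := le_max_left _ _
  have hK₂ : ℓ₁ / (8 * α) ≤ max (ℓ₁ / ℓ₀) (ℓ₁ / (8 * α)) := le_max_right _ _
  -- COMPARISON. The largest femto box of ruler 2
  set L : ℕ := ⌊ℓ₁ / a₂ β⌋₊ with hLdef
  have hLle : (L : ℝ) ≤ ℓ₁ / a₂ β := Nat.floor_le (by positivity)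
  have hLge : ℓ₁ / a₂ β - 1 < (L : ℝ) := Nat.sub_one_lt_floor _
  have h18 : (18 : ℝ) ≤ ℓ₁ / a₂ β := by
    rw [le_div_iff₀ ha₂pos]
    have := (le_div_iff₀ (by norm_num : (0 : ℝ) < 18)).1 ha₂
    linarith
  have hL17R : (17 : ℝ) ≤ (L : ℝ) := by linarith
  have hL16 : 16 ≤ L := by exact_mod_cast (show ((16 : ℕ) : ℝ) ≤ (L : ℝ) by push_cast; linarith)
  haveI : NeZero L := ⟨by omega⟩
  set n : ℕ := L / 8 with hndef
  have hn1 : 1 ≤ n := by omega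
  have h8n : 8 * n ≤ L := by omega
  have hnlt : L < 8 * n + 8 := by omega
  have hnpos : (0 : ℝ) < n := by exact_mod_cast (show 0 < n by omega)
  have hnR : (8 : ℝ) * n ≤ L := by exact_mod_cast h8n
  have hnR' : (L : ℝ) < 8 * n + 8 := by exact_mod_cast hnlt
  -- femto for ruler 2, and the ruler-2 lower bound at separation `n`
  have hfem₂ : (L : ℝ) * a₂ β ≤ ℓ₁ := by rwa [← le_div_iff₀ ha₂pos]
  obtain ⟨hax₂, -⟩ := hbox₂ L β hb₀' hfem₂
  have hlow := (hax₂ n hn1 h8n).1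
  -- `n · a₂ β ∈ [ℓ₁/16, ℓ₁/8]`
  have hA : ℓ₁ - a₂ β ≤ (L : ℝ) * a₂ β := by
    have := mul_le_mul_of_nonneg_right hLge.le ha₂pos.le
    rwa [sub_mul, div_mul_cancel₀ ℓ₁ ha₂pos.ne', one_mul] at this
  have hB : (L : ℝ) * a₂ β < 8 * ((n : ℝ) * a₂ β) + 8 * a₂ β := by
    have := mul_lt_mul_of_pos_right hnR' ha₂pos
    have e : (8 * (n : ℝ) + 8) * a₂ β = 8 * ((n : ℝ) * a₂ β) + 8 * a₂ β := by ring
    linarith [e]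
  have hC₈ : 8 * ((n : ℝ) * a₂ β) ≤ (L : ℝ) * a₂ β := by
    have := mul_le_mul_of_nonneg_right hnR ha₂pos.le
    have e : (8 : ℝ) * n * a₂ β = 8 * ((n : ℝ) * a₂ β) := by ring
    linarith [e]
  have hs₂lo : ℓ₁ / 16 ≤ (n : ℝ) * a₂ β := by linarith
  have hs₂hi : (n : ℝ) * a₂ β ≤ ℓ₁ / 8 := by linarith
  have hηle : η ≤ c' * Γ₂ ((n : ℝ) * a₂ β) := hΓ₂floor _ hs₂lo hs₂hi
  -- case split: is the box femto for ruler 1?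
  by_cases hfem₁ : (L : ℝ) * a₁ β ≤ ℓ₀
  · -- Case B: both rulers see the box; compare the bounds at separation `n`
    have hup := hbox₁ L β hb₀ hfem₁ n hn1 h8n
    have key : c' * Γ₂ ((n : ℝ) * a₂ β) ≤ C * Γ₁ ((n : ℝ) * a₁ β) := hlow.trans hup
    have hxpos : 0 < (n : ℝ) * a₁ β := mul_pos hnpos ha₁pos
    have hx₈ : 8 * ((n : ℝ) * a₁ β) ≤ (L : ℝ) * a₁ β := by
      have := mul_le_mul_of_nonneg_right hnR ha₁pos.le
      have e : (8 : ℝ) * n * a₁ β = 8 * ((n : ℝ) * a₁ β) := by ring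
      linarith [e]
    have hxle : (n : ℝ) * a₁ β ≤ ℓ₀ := by linarith
    have hΓ₁x : 0 ≤ Γ₁ ((n : ℝ) * a₁ β) := hΓ₁ _ hxpos hxle
    have hCx : C * Γ₁ ((n : ℝ) * a₁ β) ≤ Cb * Γ₁ ((n : ℝ) * a₁ β) :=
      mul_le_mul_of_nonneg_right (le_max_left C 1) hΓ₁x
    have hθx : θ ≤ Γ₁ ((n : ℝ) * a₁ β) := by
      rw [hθdef, div_le_iff₀ hCb]
      nlinarith [hηle, key, hCx]
    -- the ceiling forces `n · a₁ β` above the fixed level `α`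
    have hna : α < (n : ℝ) * a₁ β := by
      by_contra hle
      push Not at hle
      have := hsmall _ hxpos hle
      linarith
    -- hence `a₂ β ≤ ℓ₁/(8α) · a₁ β`
    have hfin : a₂ β * (8 * α) ≤ ℓ₁ * a₁ β := by
      have h1 : a₂ β * (8 * α) ≤ a₂ β * (8 * ((n : ℝ) * a₁ β)) := by
        have : 8 * α ≤ 8 * ((n : ℝ) * a₁ β) := by linarith
        exact mul_le_mul_of_nonneg_left this ha₂pos.le
      have h2 : a₂ β * (8 * ((n : ℝ) * a₁ β)) = 8 * ((n : ℝ) * a₂ β) * a₁ β := by ring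
      have h3 : 8 * ((n : ℝ) * a₂ β) * a₁ β ≤ 8 * (ℓ₁ / 8) * a₁ β :=
        mul_le_mul_of_nonneg_right (by linarith) ha₁pos.le
      have h4 : 8 * (ℓ₁ / 8) * a₁ β = ℓ₁ * a₁ β := by ring
      linarith [h1, h2, h3, h4]
    have hdom : a₂ β ≤ ℓ₁ / (8 * α) * a₁ β := by
      rw [div_mul_eq_mul_div, le_div_iff₀ (by positivity)]
      linarith
    exact hdom.trans (mul_le_mul_of_nonneg_right hK₂ ha₁pos.le)
  · -- Case A: the box is NOT femto for ruler 1, i.e. `ℓ₀ < L · a₁ β`; then `a₂ β < (ℓ₁/ℓ₀) · a₁ β`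
    push Not at hfem₁
    have h1 : a₂ β * ℓ₀ < a₂ β * ((L : ℝ) * a₁ β) := mul_lt_mul_of_pos_left hfem₁ ha₂pos
    have h2 : a₂ β * ((L : ℝ) * a₁ β) = ((L : ℝ) * a₂ β) * a₁ β := by ring
    have h3 : ((L : ℝ) * a₂ β) * a₁ β ≤ ℓ₁ * a₁ β := mul_le_mul_of_nonneg_right hfem₂ ha₁pos.le
    have hdom : a₂ β ≤ ℓ₁ / ℓ₀ * a₁ β := by
      rw [div_mul_eq_mul_div, le_div_iff₀ hℓ]
      linarith
    exact hdom.trans (mul_le_mul_of_nonneg_right hK₁ ha₁pos.le)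

/-- **One-sided domination between continuous PACKAGE rulers** (corollary: the dominating ruler's package supplies its
upper femto bound). -/
theorem ruler_dominates_continuous (r : LatticeRep G) {a₁ a₂ Γ₁ Γ₂ : ℝ → ℝ} {β₀ ℓ₀ c C β₀' ℓ₀' c' C' : ℝ}
    (h₁ : PackageWith r a₁ Γ₁ β₀ ℓ₀ c C) (h₂ : PackageWith r a₂ Γ₂ β₀' ℓ₀' c' C')
    (ha₁ : Continuous a₁) (ha₂ : Continuous a₂) :
    ∃ K β₃ : ℝ, 0 < K ∧ ∀ β, β₃ ≤ β → a₂ β ≤ K * a₁ β :=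
  ruler_dominates_of_upper r (upperFemtoBound_of_packageWith r h₁) ha₁ h₂ ha₂

/-- **Ruler rigidity (C′ form)**: any two CONTINUOUS femto rulers are equivalent up to constants, eventually in `β` —
the repaired femto socket is CANONICAL. -/
theorem rulerRigidity_continuous (r : LatticeRep G) {a₁ a₂ Γ₁ Γ₂ : ℝ → ℝ} {β₀ ℓ₀ c C β₀' ℓ₀' c' C' : ℝ}
    (h₁ : PackageWith r a₁ Γ₁ β₀ ℓ₀ c C) (h₂ : PackageWith r a₂ Γ₂ β₀' ℓ₀' c' C')
    (ha₁ : Continuous a₁) (ha₂ : Continuous a₂) :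
    ∃ K β₃ : ℝ, 0 < K ∧ ∀ β, β₃ ≤ β → a₂ β ≤ K * a₁ β ∧ a₁ β ≤ K * a₂ β := by
  obtain ⟨K₁, β₁, hK₁, hd₁⟩ := ruler_dominates_continuous r h₁ h₂ ha₁ ha₂
  obtain ⟨K₂, β₂, hK₂, hd₂⟩ := ruler_dominates_continuous r h₂ h₁ ha₂ ha₁
  refine ⟨max K₁ K₂, max β₁ β₂, lt_max_of_lt_left hK₁, fun β hβ => ⟨?_, ?_⟩⟩
  · exact (hd₁ β (le_of_max_le_left hβ)).trans
      (mul_le_mul_of_nonneg_right (le_max_left _ _) (h₁.2.2.1 β).le)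
  · exact (hd₂ β (le_of_max_le_right hβ)).trans
      (mul_le_mul_of_nonneg_right (le_max_right _ _) (h₂.2.2.1 β).le)

/-- **The monotone variant (route repair R1, gen-1 proof kept as a service lemma).** If instead of continuity of the
rulers the two SHAPE functions are monotone on their ranges, domination holds as well (`K = max(ℓ₀'/ℓ₀, ℓ₀'/(8 a₁ β₄))`).
Unused by the composition below; recorded for a route owner who prefers `MonotoneOn Γ` to `Continuous a`. -/
theorem ruler_dominates_monotone (r : LatticeRep G) {a₁ a₂ Γ₁ Γ₂ : ℝ → ℝ} {β₀ ℓ₀ c C β₀' ℓ₀' c' C' : ℝ}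
    (h₁ : PackageWith r a₁ Γ₁ β₀ ℓ₀ c C) (h₂ : PackageWith r a₂ Γ₂ β₀' ℓ₀' c' C')
    (hm₁ : MonotoneOn Γ₁ (Set.Ioc 0 ℓ₀)) (hm₂ : MonotoneOn Γ₂ (Set.Ioc 0 ℓ₀')) :
    ∃ K β₃ : ℝ, 0 < K ∧ ∀ β, β₃ ≤ β → a₂ β ≤ K * a₁ β := by
  have hv₁ : Tendsto (fun β => Γ₁ (a₁ β)) atTop (𝓝 0) := packageWith_shape_tendsto_zero r h₁
  obtain ⟨hℓ, hc, hpos₁, hlim₁, hΓ₁, hbox₁⟩ := h₁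
  obtain ⟨hℓ', hc', hpos₂, hlim₂, hΓ₂, hbox₂⟩ := h₂
  set γ : ℝ := Γ₂ (ℓ₀' / 16) with hγdef
  have hγ : 0 < γ := (hΓ₂ _ (by positivity) (by linarith)).1
  set η : ℝ := c' * γ with hηdef
  have hη : 0 < η := mul_pos hc' hγ
  set Cb : ℝ := max C 1 with hCbdef
  have hCb : 0 < Cb := lt_of_lt_of_le one_pos (le_max_right C 1)
  set θ : ℝ := η / Cb with hθdef
  have hθ : 0 < θ := div_pos hη hCb
  have hev₁ : ∀ᶠ β' in atTop, Γ₁ (a₁ β') < θ ∧ a₁ β' ≤ ℓ₀ :=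
    ((tendsto_order.1 hv₁).2 θ hθ).and (hlim₁ (Iic_mem_nhds hℓ))
  obtain ⟨β₄, hβ₄lt, hβ₄le⟩ := hev₁.exists
  set α : ℝ := a₁ β₄ with hαdef
  have hα : 0 < α := hpos₁ β₄
  have hev₂ : ∀ᶠ β in atTop, a₂ β ≤ ℓ₀' / 18 := hlim₂ (Iic_mem_nhds (by positivity))
  obtain ⟨β₅, hβ₅⟩ := Filter.eventually_atTop.1
    (hev₂.and ((eventually_ge_atTop β₀).and (eventually_ge_atTop β₀')))
  refine ⟨max (ℓ₀' / ℓ₀) (ℓ₀' / (8 * α)), β₅, lt_max_of_lt_left (div_pos hℓ' hℓ), fun β hβ => ?_⟩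
  obtain ⟨ha₂, hb₀, hb₀'⟩ := hβ₅ β hβ
  have ha₁pos : 0 < a₁ β := hpos₁ β
  have ha₂pos : 0 < a₂ β := hpos₂ β
  have hK₁ : ℓ₀' / ℓ₀ ≤ max (ℓ₀' / ℓ₀) (ℓ₀' / (8 * α)) := le_max_left _ _
  have hK₂ : ℓ₀' / (8 * α) ≤ max (ℓ₀' / ℓ₀) (ℓ₀' / (8 * α)) := le_max_right _ _
  set L : ℕ := ⌊ℓ₀' / a₂ β⌋₊ with hLdef
  have hLle : (L : ℝ) ≤ ℓ₀' / a₂ β := Nat.floor_le (by positivity)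
  have hLge : ℓ₀' / a₂ β - 1 < (L : ℝ) := Nat.sub_one_lt_floor _
  have h18 : (18 : ℝ) ≤ ℓ₀' / a₂ β := by
    rw [le_div_iff₀ ha₂pos]
    have := (le_div_iff₀ (by norm_num : (0 : ℝ) < 18)).1 ha₂
    linarith
  have hL17R : (17 : ℝ) ≤ (L : ℝ) := by linarith
  have hL16 : 16 ≤ L := by exact_mod_cast (show ((16 : ℕ) : ℝ) ≤ (L : ℝ) by push_cast; linarith)
  haveI : NeZero L := ⟨by omega⟩
  set n : ℕ := L / 8 with hndef
  have hn1 : 1 ≤ n := by omega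
  have h8n : 8 * n ≤ L := by omega
  have hnlt : L < 8 * n + 8 := by omega
  have hnpos : (0 : ℝ) < n := by exact_mod_cast (show 0 < n by omega)
  have hnR : (8 : ℝ) * n ≤ L := by exact_mod_cast h8n
  have hnR' : (L : ℝ) < 8 * n + 8 := by exact_mod_cast hnlt
  have hfem₂ : (L : ℝ) * a₂ β ≤ ℓ₀' := by rwa [← le_div_iff₀ ha₂pos]
  obtain ⟨hax₂, -⟩ := hbox₂ L β hb₀' hfem₂
  have hlow := (hax₂ n hn1 h8n).1
  have hA : ℓ₀' - a₂ β ≤ (L : ℝ) * a₂ β := by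
    have := mul_le_mul_of_nonneg_right hLge.le ha₂pos.le
    rwa [sub_mul, div_mul_cancel₀ ℓ₀' ha₂pos.ne', one_mul] at this
  have hB : (L : ℝ) * a₂ β < 8 * ((n : ℝ) * a₂ β) + 8 * a₂ β := by
    have := mul_lt_mul_of_pos_right hnR' ha₂pos
    have e : (8 * (n : ℝ) + 8) * a₂ β = 8 * ((n : ℝ) * a₂ β) + 8 * a₂ β := by ring
    linarith [e]
  have hC₈ : 8 * ((n : ℝ) * a₂ β) ≤ (L : ℝ) * a₂ β := by
    have := mul_le_mul_of_nonneg_right hnR ha₂pos.le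
    have e : (8 : ℝ) * n * a₂ β = 8 * ((n : ℝ) * a₂ β) := by ring
    linarith [e]
  have hs₂lo : ℓ₀' / 16 ≤ (n : ℝ) * a₂ β := by linarith
  have hs₂hi : (n : ℝ) * a₂ β ≤ ℓ₀' / 8 := by linarith
  have hs₂pos : 0 < (n : ℝ) * a₂ β := mul_pos hnpos ha₂pos
  have hΓ₂ge : γ ≤ Γ₂ ((n : ℝ) * a₂ β) :=
    hm₂ ⟨by positivity, by linarith⟩ ⟨hs₂pos, by linarith⟩ hs₂lo
  have hηle : η ≤ c' * Γ₂ ((n : ℝ) * a₂ β) := mul_le_mul_of_nonneg_left hΓ₂ge hc'.le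
  by_cases hfem₁ : (L : ℝ) * a₁ β ≤ ℓ₀
  · obtain ⟨hax₁, -⟩ := hbox₁ L β hb₀ hfem₁
    have hup := (hax₁ n hn1 h8n).2
    have key : c' * Γ₂ ((n : ℝ) * a₂ β) ≤ C * Γ₁ ((n : ℝ) * a₁ β) := hlow.trans hup
    have hxpos : 0 < (n : ℝ) * a₁ β := mul_pos hnpos ha₁pos
    have hx₈ : 8 * ((n : ℝ) * a₁ β) ≤ (L : ℝ) * a₁ β := by
      have := mul_le_mul_of_nonneg_right hnR ha₁pos.le
      have e : (8 : ℝ) * n * a₁ β = 8 * ((n : ℝ) * a₁ β) := by ring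
      linarith [e]
    have hxle : (n : ℝ) * a₁ β ≤ ℓ₀ := by linarith
    have hΓ₁x : 0 < Γ₁ ((n : ℝ) * a₁ β) := (hΓ₁ _ hxpos hxle).1
    have hCx : C * Γ₁ ((n : ℝ) * a₁ β) ≤ Cb * Γ₁ ((n : ℝ) * a₁ β) :=
      mul_le_mul_of_nonneg_right (le_max_left C 1) hΓ₁x.le
    have hθx : θ ≤ Γ₁ ((n : ℝ) * a₁ β) := by
      rw [hθdef, div_le_iff₀ hCb]
      nlinarith [hηle, key, hCx]
    have hna : α < (n : ℝ) * a₁ β := by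
      by_contra hle
      push Not at hle
      have hmon : Γ₁ ((n : ℝ) * a₁ β) ≤ Γ₁ α := hm₁ ⟨hxpos, hxle⟩ ⟨hα, hβ₄le⟩ hle
      linarith
    have hfin : a₂ β * (8 * α) ≤ ℓ₀' * a₁ β := by
      have h1 : a₂ β * (8 * α) ≤ a₂ β * (8 * ((n : ℝ) * a₁ β)) := by
        have : 8 * α ≤ 8 * ((n : ℝ) * a₁ β) := by linarith
        exact mul_le_mul_of_nonneg_left this ha₂pos.le
      have h2 : a₂ β * (8 * ((n : ℝ) * a₁ β)) = 8 * ((n : ℝ) * a₂ β) * a₁ β := by ring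
      have h3 : 8 * ((n : ℝ) * a₂ β) * a₁ β ≤ 8 * (ℓ₀' / 8) * a₁ β :=
        mul_le_mul_of_nonneg_right (by linarith) ha₁pos.le
      have h4 : 8 * (ℓ₀' / 8) * a₁ β = ℓ₀' * a₁ β := by ring
      linarith [h1, h2, h3, h4]
    have hdom : a₂ β ≤ ℓ₀' / (8 * α) * a₁ β := by
      rw [div_mul_eq_mul_div, le_div_iff₀ (by positivity)]
      linarith
    exact hdom.trans (mul_le_mul_of_nonneg_right hK₂ ha₁pos.le)
  · push Not at hfem₁
    have h1 : a₂ β * ℓ₀ < a₂ β * ((L : ℝ) * a₁ β) := mul_lt_mul_of_pos_left hfem₁ ha₂pos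
    have h2 : a₂ β * ((L : ℝ) * a₁ β) = ((L : ℝ) * a₂ β) * a₁ β := by ring
    have h3 : ((L : ℝ) * a₂ β) * a₁ β ≤ ℓ₀' * a₁ β := mul_le_mul_of_nonneg_right hfem₂ ha₁pos.le
    have hdom : a₂ β ≤ ℓ₀' / ℓ₀ * a₁ β := by
      rw [div_mul_eq_mul_div, le_div_iff₀ hℓ]
      linarith
    exact hdom.trans (mul_le_mul_of_nonneg_right hK₁ ha₁pos.le)

/-- **Domination transfer of the conclusion** (= Disproof §1 `concl_of_eventually_le` ∘ §2 `concl_smul_iff`; same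
statement as the sibling line's `KnabeBlockSampler.concl_of_dominated`): clustering in the units of `a'` and
`a ≤ K₀ a'` eventually give clustering in the units of `a` with rate constant `c₁/K₀`. -/
theorem concl_of_dominated (r : LatticeRep G) {a a' : ℝ → ℝ} (h : Concl r a') {K₀ : ℝ} (hK : 0 < K₀)
    (hdom : ∀ᶠ β in atTop, a β ≤ K₀ * a' β) : Concl r a := by
  obtain ⟨c₁, β₂, S₁, hc, h⟩ := h
  obtain ⟨βs, hβs⟩ := eventually_atTop.1 hdom
  refine ⟨c₁ / K₀, max β₂ βs, S₁, div_pos hc hK, fun A B => ?_⟩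
  obtain ⟨C, hC⟩ := h A B
  refine ⟨max C 0, fun β hβ S n hS hn => ?_⟩
  have hβ₂ : β₂ ≤ β := (le_max_left _ _).trans hβ
  have hle : a β ≤ K₀ * a' β := hβs β ((le_max_right _ _).trans hβ)
  refine (hC β hβ₂ S n hS hn).trans ?_
  have hn0 : (0 : ℝ) ≤ n := Nat.cast_nonneg n
  have key : c₁ / K₀ * a β * n ≤ c₁ * a' β * n := by
    refine mul_le_mul_of_nonneg_right ?_ hn0
    calc c₁ / K₀ * a β ≤ c₁ / K₀ * (K₀ * a' β) := mul_le_mul_of_nonneg_left hle (div_pos hc hK).le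
      _ = c₁ / K₀ * K₀ * a' β := by ring
      _ = c₁ * a' β := by rw [div_mul_cancel₀ c₁ hK.ne']
  calc C * Real.exp (-(c₁ * a' β * n)) ≤ max C 0 * Real.exp (-(c₁ * a' β * n)) :=
        mul_le_mul_of_nonneg_right (le_max_left _ _) (Real.exp_pos _).le
    _ ≤ max C 0 * Real.exp (-(c₁ / K₀ * a β * n)) :=
        mul_le_mul_of_nonneg_left (Real.exp_le_exp.2 (neg_le_neg key)) (le_max_right _ _)

end Rigidity

/-! ## §3 The femto window and the engine -/

section Window

variable {G : Type} [Group G] [TopologicalSpace G] [IsTopologicalGroup G] [CompactSpace G]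
  [MeasurableSpace G] [BorelSpace G]

/-- **TV finite-size window** of the Wilson specification `ymSpecification ρ β` at cell size `b`, cube radius `n`
(in cells) and threshold `ε`: for every `[b, 2b]`-frame `w`, every cell-union `Y` inside the cube of `(4n+1)⁴` cells
containing the central cell, every pair of boundary conditions agreeing on the cube, and every `[0,1]`-valued
measurable cylinder function `f` of the central cell, the two conditional expectations of `f` differ by at most `ε`.
VERBATIM the hypothesis block of `OneCertifiedCube.FiniteSizeCriterion` (item stmt-QuantumFields-8895) and of
`OneCertifiedCube.CrossoverCertificate` (stmt-QuantumFields-8893), abstracted over `(ρ, β, b, n, ε)`. -/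
def TVWindow {N : ℕ} (ρ : G →* Matrix (Fin N) (Fin N) ℂ) (β : ℝ) (b n : ℕ) (ε : ℝ) : Prop :=
  ∀ w : Fin 4 → ℤ → ℤ, (∀ i j, w i j + ((b : ℕ) : ℤ) ≤ w i (j + 1) ∧ w i (j + 1) ≤ w i j + 2 * ((b : ℕ) : ℤ)) →
    ∀ Y : Finset (Fin 4 → ℤ), Y ⊆ (Fintype.piFinset fun _ : Fin 4 => Finset.Icc (-(2 * ((n : ℕ) : ℤ))) (2 * ((n : ℕ) : ℤ))) → (0 : Fin 4 → ℤ) ∈ Y →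
    ∀ η η' : LGConfig 4 G, (∀ e ∈ (Fintype.piFinset fun _ : Fin 4 => Finset.Icc (-(2 * ((n : ℕ) : ℤ))) (2 * ((n : ℕ) : ℤ))).biUnion (fun y : Fin 4 → ℤ => (Fintype.piFinset fun i : Fin 4 => Finset.Ico (w i (y i)) (w i (y i + 1))) ×ˢ (Finset.univ : Finset (Fin 4))), η e = η' e) →
    ∀ f : LGConfig 4 G → ℝ, IsCylinder f ((fun y : Fin 4 → ℤ => (Fintype.piFinset fun i : Fin 4 => Finset.Ico (w i (y i)) (w i (y i + 1))) ×ˢ (Finset.univ : Finset (Fin 4))) 0) →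
    Measurable f →
    (∀ U, 0 ≤ f U ∧ f U ≤ 1) →
    |(∫ U, f U ∂(ymSpecification ρ β (Y.biUnion (fun y : Fin 4 → ℤ => (Fintype.piFinset fun i : Fin 4 => Finset.Ico (w i (y i)) (w i (y i + 1))) ×ˢ (Finset.univ : Finset (Fin 4)))) η)) - ∫ U, f U ∂(ymSpecification ρ β (Y.biUnion (fun y : Fin 4 → ℤ => (Fintype.piFinset fun i : Fin 4 => Finset.Ico (w i (y i)) (w i (y i + 1))) ×ˢ (Finset.univ : Finset (Fin 4)))) η')| ≤ ε

/-- The universal (interaction-free, group-free) threshold of the finite-size criterion: `ε · M(n) < 1`,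
`M(n) = (4n+3)⁴ − (4n+1)⁴` = the number of cells in the shell of thickness one cell around the cube. -/
def ThresholdOK (n : ℕ) (ε : ℝ) : Prop :=
  1 ≤ n ∧ 0 ≤ ε ∧ ε * ((((4 * n + 3) ^ 4 - (4 * n + 1) ^ 4 : ℕ)) : ℝ) < 1

/-- **Femto window certificate of the unit map `a`** (single cell): ONE `(Θ, n, ε)` with `ThresholdOK n ε` such that
for ALL `β ≥ β⋆` the TV window holds at the femto cell `b(β) = ⌈Θ / a(β)⌉` — what the engine consumes. -/
def FemtoWindowCertificate (r : LatticeRep G) (a : ℝ → ℝ) : Prop :=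
  ∃ (Θ : ℝ) (n : ℕ) (ε β₁ : ℝ), 0 < Θ ∧ ThresholdOK n ε ∧ ∀ β : ℝ, β₁ ≤ β → TVWindow r.ρ β ⌈Θ / a β⌉₊ n ε

/-- **Femto windows FROM `Θ₀` femto-lengths on** (all cells beyond a fixed number of femto-lengths are TV-mixing, one
`(n, ε)` for all `β ≥ β⋆`): the form in which the certificate is MONOTONE along ruler domination
(`femtoWindowFrom_of_dominated`) and hence, by rigidity, independent of the continuous femto ruler it is stated in
(`femtoWindowFrom_transfer`). In the units `L₀(β) ∝ 1/a(β)` the infrared problem spans a `β`-independent number of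
octaves, so one `Θ₀` serves every `β` (card `one-ruler`). -/
def FemtoWindowFrom (r : LatticeRep G) (a : ℝ → ℝ) : Prop :=
  ∃ (Θ₀ : ℝ) (n : ℕ) (ε β₁ : ℝ), 0 < Θ₀ ∧ ThresholdOK n ε ∧
    ∀ β : ℝ, β₁ ≤ β → ∀ b : ℕ, Θ₀ / a β ≤ (b : ℝ) → TVWindow r.ρ β b n ε

theorem femtoWindowCertificate_of_from (r : LatticeRep G) {a : ℝ → ℝ} (h : FemtoWindowFrom r a) :
    FemtoWindowCertificate r a := by
  obtain ⟨Θ₀, n, ε, β₁, hΘ, hT, hwin⟩ := h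
  exact ⟨Θ₀, n, ε, β₁, hΘ, hT, fun β hβ => hwin β hβ _ (Nat.le_ceil _)⟩

/-- **Windows-from are monotone along domination**: if `a ≤ K · aR` eventually (`a` not slower than `aR`) and every cell
beyond `Θ₀/aR` is mixing, then every cell beyond `KΘ₀/a` is mixing. -/
theorem femtoWindowFrom_of_dominated (r : LatticeRep G) {a aR : ℝ → ℝ} (ha : ∀ β, 0 < a β) {K : ℝ} (hK : 0 < K)
    (hdom : ∀ᶠ β in atTop, a β ≤ K * aR β) (h : FemtoWindowFrom r aR) : FemtoWindowFrom r a := by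
  obtain ⟨Θ₀, n, ε, β₁, hΘ, hT, hwin⟩ := h
  obtain ⟨βd, hβd⟩ := eventually_atTop.1 hdom
  refine ⟨K * Θ₀, n, ε, max β₁ βd, mul_pos hK hΘ, hT, fun β hβ b hb => hwin β (le_of_max_le_left hβ) b ?_⟩
  have hle : a β ≤ K * aR β := hβd β (le_of_max_le_right hβ)
  have hapos : 0 < a β := ha β
  have haRpos : 0 < aR β := by
    by_contra hneg
    push Not at hneg
    have : K * aR β ≤ 0 := mul_nonpos_of_nonneg_of_nonpos hK.le hneg
    linarith
  calc Θ₀ / aR β = K * Θ₀ / (K * aR β) := by rw [mul_div_mul_left _ _ hK.ne']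
    _ ≤ K * Θ₀ / a β := div_le_div_of_nonneg_left (by positivity) hapos hle
    _ ≤ b := hb

/-- **The certificate does not depend on the continuous femto ruler it is stated in** (rigidity at work): windows-from
in ONE continuous package ruler give windows-from in EVERY continuous package ruler. -/
theorem femtoWindowFrom_transfer (r : LatticeRep G) {aR a ΓR Γ : ℝ → ℝ} {β₀ ℓ₀ c C β₀' ℓ₀' c' C' : ℝ}
    (hR : PackageWith r aR ΓR β₀ ℓ₀ c C) (haR : Continuous aR) (hW : FemtoWindowFrom r aR)
    (h : PackageWith r a Γ β₀' ℓ₀' c' C') (ha : Continuous a) : FemtoWindowFrom r a := by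
  obtain ⟨K, β₃, hK, hdom⟩ := ruler_dominates_continuous r hR h haR ha
  exact femtoWindowFrom_of_dominated r h.2.2.1 hK (eventually_atTop.2 ⟨β₃, hdom⟩) hW

/-- **… and an UPPER femto bound for the reference ruler suffices** (the prover's reduction of `stub_femtoWindow` to an
explicit ruler `aR`: certify windows from `Θ₀/aR` and a perturbative upper bound with vanishing shape for `aR`; no lower
bound and no package for `aR` is needed). -/
theorem femtoWindowFrom_of_upperRuler (r : LatticeRep G) {aR a ΓR Γ : ℝ → ℝ} {β₀ ℓ₀ C β₀' ℓ₀' c' C' : ℝ}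
    (hR : UpperFemtoBound r aR ΓR β₀ ℓ₀ C) (haR : Continuous aR) (hW : FemtoWindowFrom r aR)
    (h : PackageWith r a Γ β₀' ℓ₀' c' C') (ha : Continuous a) : FemtoWindowFrom r a := by
  obtain ⟨K, β₃, hK, hdom⟩ := ruler_dominates_of_upper r hR haR h ha
  exact femtoWindowFrom_of_dominated r h.2.2.1 hK (eventually_atTop.2 ⟨β₃, hdom⟩) hW

/-- **Engine output ⇒ `Concl` (the card's constant-slack bookkeeping, PROVED).** If the finite-size criterion holds
and `a` (positive, `a → 0`) has a femto window certificate at `(Θ, n, ε)`, then all pairs cluster at rate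
`(κ/(2Θ)) · a(β)` on every torus `2S+1` with `S ≥ S₁(β) := (8n+7)⌈Θ/a(β)⌉`, `β ≥ max β₁ βΘ` (`a ≤ Θ` beyond `βΘ`,
so that `a · ⌈Θ/a⌉ ≤ 2Θ`), constants `C(A, B) = max C 0` from the engine — independent of `β, S, n`. -/
theorem concl_of_window (hF : Summit.QuantumFields.YangMills.Theses.OneCertifiedCube.FiniteSizeCriterion)
    (r : LatticeRep G) {a : ℝ → ℝ} (ha : ∀ β, 0 < a β) (hlim : Tendsto a atTop (𝓝 0))
    (hW : FemtoWindowCertificate r a) : Concl r a := by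
  obtain ⟨Θ, n, ε, β₁, hΘ, ⟨hn, hε, hεM⟩, hwin⟩ := hW
  obtain ⟨κ, hκ, H⟩ := hF n ε hn hε hεM
  obtain ⟨βΘ, hβΘ⟩ := Filter.eventually_atTop.1 (hlim (Iic_mem_nhds hΘ))
  refine ⟨κ / (2 * Θ), max β₁ βΘ, fun β => (8 * n + 7) * ⌈Θ / a β⌉₊, div_pos hκ (by positivity), fun A B => ?_⟩
  obtain ⟨C, hC⟩ := H G r.N r.ρ r.continuous r.injective A B
  refine ⟨max C 0, fun β hβ S t hS ht => ?_⟩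
  have hβ₁ : β₁ ≤ β := le_of_max_le_left hβ
  have haΘ : a β ≤ Θ := hβΘ β (le_of_max_le_right hβ)
  have hapos : 0 < a β := ha β
  set b : ℕ := ⌈Θ / a β⌉₊ with hbdef
  have hbpos : 0 < b := Nat.ceil_pos.2 (div_pos hΘ hapos)
  have hb1 : 1 ≤ b := hbpos
  have hbR : (0 : ℝ) < (b : ℝ) := by exact_mod_cast hbpos
  have hbub : (b : ℝ) < Θ / a β + 1 := Nat.ceil_lt_add_one (div_pos hΘ hapos).le
  have hab : a β * (b : ℝ) ≤ 2 * Θ := by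
    have h1 : a β * (b : ℝ) ≤ a β * (Θ / a β + 1) := mul_le_mul_of_nonneg_left hbub.le hapos.le
    have h2 : a β * (Θ / a β + 1) = Θ + a β := by field_simp
    linarith
  have hS' : (8 * n + 7) * b ≤ 2 * S + 1 := by
    have : (8 * n + 7) * b ≤ S := hS
    omega
  have key := hC β b hb1 (hwin β hβ₁) S hS' t ht
  refine key.trans ?_
  have ht0 : (0 : ℝ) ≤ (t : ℝ) := Nat.cast_nonneg t
  have hrate : κ / (2 * Θ) * a β * t ≤ κ * t / b := by
    have hq : a β / (2 * Θ) ≤ 1 / (b : ℝ) := by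
      rw [div_le_div_iff₀ (by positivity) hbR]
      linarith
    have hmul := mul_le_mul_of_nonneg_left hq (mul_nonneg hκ.le ht0)
    have e1 : κ / (2 * Θ) * a β * t = κ * t * (a β / (2 * Θ)) := by ring
    have e2 : κ * t / b = κ * t * (1 / (b : ℝ)) := by ring
    rw [e1, e2]
    exact hmul
  calc C * Real.exp (-(κ * t / b)) ≤ max C 0 * Real.exp (-(κ * t / b)) :=
        mul_le_mul_of_nonneg_right (le_max_left _ _) (Real.exp_pos _).le
    _ ≤ max C 0 * Real.exp (-(κ / (2 * Θ) * a β * t)) :=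
        mul_le_mul_of_nonneg_left (Real.exp_le_exp.2 (neg_le_neg hrate)) (le_max_right _ _)

end Window

/-! ## §4 The three stubs -/

/-- **Stub S0 statement — ruler reduction (the typed-`∀a` socket; VERBATIM the sibling line's
`KnabeBlockSampler.RulerReduction`, so the two lines of this crux share ONE socket and ONE repair).** Every unit map
carrying the femto package is eventually dominated, up to a constant, by a CONTINUOUS unit map carrying the package.
The identity on continuous rulers (`rulerReduction_of_continuous`); for the slow STEP rulers of the Disproof's PAPER KILL
it is (physically) false exactly as the crux is — this is where the typed crux's misstatement is parked. NOT A WORK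
ITEM: it becomes moot when 9366 is restated as C′ (`cruxRepaired_of` needs no S0). -/
def RulerReduction : Prop :=
  ∀ (G : Type) [Group G] [TopologicalSpace G] [IsTopologicalGroup G] [CompactSpace G],
    IsCompactSimpleLieGroup G →
      letI : MeasurableSpace G := borel G
      haveI : BorelSpace G := ⟨rfl⟩
      ∀ (r : LatticeRep G) (a : ℝ → ℝ), Package r a →
        ∃ (a' : ℝ → ℝ) (K₀ : ℝ), Continuous a' ∧ Package r a' ∧ 0 < K₀ ∧ ∀ᶠ β in atTop, a β ≤ K₀ * a' β

/-- **Stub S1 statement — THE PHYSICS (hardest, open): femto windows in the units of every continuous femto ruler.**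
For every compact simple `G`, faithful `r` and CONTINUOUS unit map `a` carrying the femto package there are `Θ₀`, `n`,
`ε` with the universal threshold `ε·M(n) < 1` and `β⋆` such that for all `β ≥ β⋆` the TV finite-size window of the
Wilson specification at `β` holds at EVERY cell size `b ≥ Θ₀/a(β)`: dimensional transmutation typed as a
finite-volume, one-functional, fixed-scale-ratio threshold. By `femtoWindowFrom_transfer` it is EQUIVALENT to its
`∃`-over-rulers form (certify in ONE continuous femto ruler of your choice), and by `femtoWindowFrom_of_upperRuler` it
follows from windows-from in ANY explicit continuous ruler `aR` carrying a perturbative UPPER femto bound with vanishing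
shape (two-loop `a_phys`, a step-scaling unit, Bałaban's `M^{−j(β)}`): `femtoWindow_of_uvRuler`. -/
def FemtoWindowStub : Prop :=
  ∀ (G : Type) [Group G] [TopologicalSpace G] [IsTopologicalGroup G] [CompactSpace G],
    IsCompactSimpleLieGroup G →
      letI : MeasurableSpace G := borel G
      haveI : BorelSpace G := ⟨rfl⟩
      ∀ (r : LatticeRep G) (a : ℝ → ℝ), Continuous a → Package r a → FemtoWindowFrom r a

/-- **stub_finiteSizeCriterion** — THE ENGINE = item `stmt-QuantumFields-8895` BY NAME (route OneCertifiedCube's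
support item, difficulty L; Dobrushin–Shlosman / Martinelli–Olivieri type: TV finite-size condition at one cell size
with interaction-free threshold `ε·M(n) < 1` ⇒ exponential clustering `C(A,B) e^{−κ t/b}` on every symmetric torus
`2S+1 ≥ (8n+7)b`, `G`-blind, `β`-blind; torus-native, so no transfer matrix / thermal trace is ever formed). Prove it
THERE (`--workitem stmt-QuantumFields-8895`); this stub is then its `_holds` theorem by name. -/
theorem stub_finiteSizeCriterion :
    Summit.QuantumFields.YangMills.Theses.OneCertifiedCube.FiniteSizeCriterion := by
  sorry

/-- **stub_femtoWindow** — THE PHYSICS (hardest; see `FemtoWindowStub`). Why plausibly true: a continuous femto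
package pins its ruler to the physical lattice spacing up to constants (rigidity is PROVED here for continuous rulers;
Disproof docblock "for CONTINUOUS `a` … pins `a ≍ a_phys`"), so `Θ₀/a(β)` is a FIXED physical length for all `β`;
a confining theory has boundary influence `≍ e^{−m·2nΘ₀'}` on a cell at distance `2n` cells, interior link marginals
are Haar under every boundary condition (interior gauge invariance: the TV distance on a cell is carried by its
gauge-INVARIANT σ-algebra), and `εM(n) < 1` needs `mΘ₀' ≈ 4–5` only (OneCertifiedCube NUMBERS). Why it might fail:
TV smallness on the FULL (gauge-invariant) cell σ-algebra uniformly over ALL exterior data near the continuum —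
(i) coherent-small-shift × many-d.o.f. amplification (refuter rreview-0815T13-6-g3's massive-GFF caricature on 8893:
Cameron–Martin distance linear in `b` for physically divergent boundary data; for compact non-abelian `G` the boundary
amplitude reaching the centre is physically bounded — screening/instability of strong coherent flux — so the linear
divergence has no direct analogue, but a slow growth from some coherent family of UV composites is not excluded);
(ii) strong exterior flux must unwind within `n` cells (fails for `U(1)₄`: excluded by simplicity; a weak-coupling
massless phase of a simple `G` is exactly `¬`crux); (iii) the fixed `[b,2b]`-frame / seam shapes of the typed block. -/
theorem stub_femtoWindow : FemtoWindowStub := by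
  sorry

/-- **stub_rulerReduction** — THE TYPED-DEFECT SOCKET (do NOT staff; see `RulerReduction`). -/
theorem stub_rulerReduction : RulerReduction := by
  sorry

/-! ## §5 Composition: the skeleton concludes the crux BY NAME; C′ needs no socket -/

section Composition

variable {G : Type} [Group G] [TopologicalSpace G] [IsTopologicalGroup G] [CompactSpace G]
  [MeasurableSpace G] [BorelSpace G]

/-- S0 is the identity on continuous rulers (so under the repair C′ it carries no content). -/
theorem rulerReduction_of_continuous (r : LatticeRep G) {a : ℝ → ℝ} (ha : Continuous a) (hP : Package r a) :
    ∃ (a' : ℝ → ℝ) (K₀ : ℝ), Continuous a' ∧ Package r a' ∧ 0 < K₀ ∧ ∀ᶠ β in atTop, a β ≤ K₀ * a' β :=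
  ⟨a, 1, ha, hP, one_pos, Eventually.of_forall fun β => by simp⟩

/-- **Physics + engine ⇒ `Concl` in the units of every continuous package ruler.** -/
theorem concl_of_stubs (hW : FemtoWindowStub)
    (hF : Summit.QuantumFields.YangMills.Theses.OneCertifiedCube.FiniteSizeCriterion)
    {G : Type} [Group G] [TopologicalSpace G] [IsTopologicalGroup G] [CompactSpace G]
    (hG : IsCompactSimpleLieGroup G) :
    letI : MeasurableSpace G := borel G
    haveI : BorelSpace G := ⟨rfl⟩
    ∀ (r : LatticeRep G) (a : ℝ → ℝ), Continuous a → Package r a → Concl r a := by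
  letI : MeasurableSpace G := borel G
  haveI : BorelSpace G := ⟨rfl⟩
  intro r a ha hP
  have hWin : FemtoWindowFrom r a := hW G hG r a ha hP
  obtain ⟨Γ, β₀, ℓ₀, c, C, hPw⟩ := hP
  exact concl_of_window hF r hPw.2.2.1 hPw.2.2.2.1 (femtoWindowCertificate_of_from r hWin)

end Composition

/-- **The repaired crux C′ from the physics stub and the engine ALONE** (no socket, no defect carrier). -/
theorem cruxRepaired_of : CruxRepaired := by
  intro G _ _ _ _ hG
  exact concl_of_stubs stub_femtoWindow stub_finiteSizeCriterion hG

/-- **The reduction statement**: the three stub statements imply the crux (by name). -/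
def StubsImplyCrux : Prop :=
  RulerReduction → FemtoWindowStub →
    Summit.QuantumFields.YangMills.Theses.OneCertifiedCube.FiniteSizeCriterion → LatticeGapInUVUnits

/-- **The composition (kernel-checked, no `sorry`).** S0 hands a continuous dominating ruler `a'` with the package;
physics + engine give `Concl r a'`; `concl_of_dominated` returns to the units of `a`. -/
theorem stubsImplyCrux : StubsImplyCrux := by
  intro h0 hW hF
  rw [crux_iff]
  intro G _ _ _ _ hG
  letI : MeasurableSpace G := borel G
  haveI : BorelSpace G := ⟨rfl⟩
  intro r a hP
  obtain ⟨a', K₀, ha', hP', hK₀, hdom⟩ := h0 G hG r a hP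
  exact concl_of_dominated r (concl_of_stubs hW hF hG r a' ha' hP') hK₀ hdom

/-- **The line.** `LatticeGapInUVUnits` BY NAME from the three registered stubs; everything else (uncurrying,
rigidity and its two analytic inputs, the engine-to-`Concl` bookkeeping, the domination transfer) is proved above. -/
theorem LatticeGapInUVUnits_of : LatticeGapInUVUnits :=
  stubsImplyCrux stub_rulerReduction stub_femtoWindow stub_finiteSizeCriterion

/-- **The prover's reduction of the physics stub to ONE explicit ruler** (foreseen split of `stub_femtoWindow`, typed
and PROVED as glue): it suffices to exhibit, for every compact simple `G` and `r`, SOME continuous ruler `aR` with an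
UPPER femto bound of vanishing shape (UV child: tree level + asymptotic freedom, no lower bound) and windows from
`Θ₀/aR` (IR child: TV mixing beyond a fixed number of `aR`-lengths). -/
theorem femtoWindow_of_uvRuler
    (h : ∀ (G : Type) [Group G] [TopologicalSpace G] [IsTopologicalGroup G] [CompactSpace G],
      IsCompactSimpleLieGroup G →
        letI : MeasurableSpace G := borel G
        haveI : BorelSpace G := ⟨rfl⟩
        ∀ (r : LatticeRep G), (∃ a : ℝ → ℝ, Continuous a ∧ Package r a) →
          ∃ (aR ΓR : ℝ → ℝ) (β₀ ℓ₀ C : ℝ), Continuous aR ∧ UpperFemtoBound r aR ΓR β₀ ℓ₀ C ∧ FemtoWindowFrom r aR) :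
    FemtoWindowStub := by
  intro G _ _ _ _ hG
  letI : MeasurableSpace G := borel G
  haveI : BorelSpace G := ⟨rfl⟩
  intro r a ha hP
  obtain ⟨aR, ΓR, β₀, ℓ₀, C, haR, hU, hW⟩ := h G hG r ⟨a, ha, hP⟩
  obtain ⟨Γ, β₀', ℓ₀', c', C', hPw⟩ := hP
  exact femtoWindowFrom_of_upperRuler r hU haR hW hPw ha

/-- **`∀` over continuous femto rulers = `∃`** (rigidity at work): the physics stub is EQUIVALENT to certifying
windows-from in ONE continuous package ruler per `(G, r)` — the prover picks the ruler. -/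
theorem femtoWindowStub_iff_exists :
    FemtoWindowStub ↔
      ∀ (G : Type) [Group G] [TopologicalSpace G] [IsTopologicalGroup G] [CompactSpace G],
        IsCompactSimpleLieGroup G →
          letI : MeasurableSpace G := borel G
          haveI : BorelSpace G := ⟨rfl⟩
          ∀ (r : LatticeRep G), (∃ a : ℝ → ℝ, Continuous a ∧ Package r a) →
            ∃ a : ℝ → ℝ, Continuous a ∧ Package r a ∧ FemtoWindowFrom r a := by
  constructor
  · intro h G _ _ _ _ hG
    letI : MeasurableSpace G := borel G
    haveI : BorelSpace G := ⟨rfl⟩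
    intro r hex
    obtain ⟨a, ha, hP⟩ := hex
    exact ⟨a, ha, hP, h G hG r a ha hP⟩
  · intro h G _ _ _ _ hG
    letI : MeasurableSpace G := borel G
    haveI : BorelSpace G := ⟨rfl⟩
    intro r a ha hP
    obtain ⟨aR, haR, hPR, hW⟩ := h G hG r ⟨a, ha, hP⟩
    obtain ⟨ΓR, β₀, ℓ₀, c, C, hPRw⟩ := hPR
    obtain ⟨Γ, β₀', ℓ₀', c', C', hPw⟩ := hP
    exact femtoWindowFrom_transfer r hPRw haR hW hPw ha

/-! ## §6 Negative side (PROVED shape; for cdisprove and the route owner — NOT part of the line) and checks against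
the landed Negative lemmas -/

section Negative

variable {G : Type} [Group G] [TopologicalSpace G] [IsTopologicalGroup G] [CompactSpace G]
  [MeasurableSpace G] [BorelSpace G]

/-- A quantitative LOWER bound on SOME pair's torus correlations at rate `m(β)` per lattice step, in the shape dual
to `Concl`. -/
def LowerBoundAtRate (r : LatticeRep G) (m : ℝ → ℝ) : Prop :=
  ∃ (A B : YMSpecies G) (β₆ : ℝ), ∀ β : ℝ, β₆ ≤ β → ∃ Amp : ℝ, 0 < Amp ∧ ∀ S₀ : ℕ, ∃ S : ℕ, S₀ ≤ S ∧
    Amp * Real.exp (-(m β * S)) ≤ |latticeConnectedCorr r.ρ β (2 * S + 1) A.F B.F S|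

/-- No femto package has a shape bounded below on `(0, ℓ₀]` (Disproof §6 `not_packageWith_of_shape_ge`, from the landed
concentration lemma): the physics stub is never asked to serve such a package. -/
theorem not_packageWith_of_shape_ge (r : LatticeRep G) {a Γ : ℝ → ℝ} {β₀ ℓ₀ c C γ₀ : ℝ} (hγ : 0 < γ₀)
    (hΓ : ∀ s : ℝ, 0 < s → s ≤ ℓ₀ → γ₀ ≤ Γ s) : ¬ PackageWith r a Γ β₀ ℓ₀ c C := by
  intro h
  have ht := packageWith_shape_tendsto_zero r h
  obtain ⟨hℓ, -, hpos, hlim, -, -⟩ := h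
  have hev : ∀ᶠ β in atTop, a β < ℓ₀ := hlim (Iio_mem_nhds hℓ)
  have hlt : ∀ᶠ β in atTop, Γ (a β) < γ₀ := (tendsto_order.1 ht).2 _ hγ
  obtain ⟨β, h1, h2⟩ := (hev.and hlt).exists
  exact absurd (hΓ (a β) (hpos β) h1.le) (not_le.2 h2)

/-- The uniform-constant strengthening `∃ C ∀ A B` of `Concl` is REFUTED for compact simple `G` (landed
`Negative/UniformConstantFalse.lean`, p74453): every `Concl` produced in this file carries the engine's PER-PAIR constant
`max C(A,B) 0`, never a uniform one. -/
example (hG : IsCompactSimpleLieGroup G) (r : LatticeRep G) (a : ℝ → ℝ) :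
    ¬ ∃ (c₁ β₂ C : ℝ) (S₁ : ℝ → ℕ), 0 < c₁ ∧ ∀ A B : YMSpecies G, ∀ β : ℝ, β₂ ≤ β → ∀ S n : ℕ,
      S₁ β ≤ S → n ≤ S →
        |latticeConnectedCorr r.ρ β (2 * S + 1) A.F B.F n| ≤ C * Real.exp (-(c₁ * a β * n)) :=
  not_uniform_constant_clustering_of_simple hG r a

end Negative

/-- **The crux as typed is refuted by a slow ruler** (bookkeeping, PROVED): if for ONE compact simple `G` and `r`
some unit map `a` carries the femto package while some pair obeys a lower bound at a rate `m = o(a)`, then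
`¬ LatticeGapInUVUnits` (`A e^{−mS} ≤ C e^{−c₁ a S}` for unboundedly many `S` forces `m ≥ c₁ a`). Inputs (none in the
tree): `Package` for a sub-exponential STEP ruler (crux 9363's card generic-step-gamma-encoding) and `LowerBoundAtRate`
(`XiCompleteMonotonicity.XiExpLowerBound` 8935, or `PolynomialWindow` 8937 + `AxialLogConvexity` 8940); the SU(n)
instance is unconditional (`isSimpleCompactGroup_specialUnitaryGroup_holds`). This is what kills `stub_rulerReduction`. -/
theorem not_crux_of_slow_ruler
    (hex : ∃ (G : Type) (_ : Group G) (_ : TopologicalSpace G) (_ : IsTopologicalGroup G) (_ : CompactSpace G),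
      IsCompactSimpleLieGroup G ∧
        letI : MeasurableSpace G := borel G
        haveI : BorelSpace G := ⟨rfl⟩
        ∃ (r : LatticeRep G) (a m : ℝ → ℝ), Package r a ∧ LowerBoundAtRate r m ∧
          Tendsto (fun β => m β / a β) atTop (𝓝 0)) :
    ¬ LatticeGapInUVUnits := by
  intro hcrux
  obtain ⟨G, iG, iT, iTG, iC, hG, hrest⟩ := hex
  letI : MeasurableSpace G := borel G
  haveI : BorelSpace G := ⟨rfl⟩
  obtain ⟨r, a, m, hP, hLB, hlim⟩ := hrest
  have hC : Concl r a := crux_iff.1 hcrux G hG r a hP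
  obtain ⟨c₁, β₂, S₁, hc₁, hAB⟩ := hC
  obtain ⟨A, B, β₆, hβ⟩ := hLB
  obtain ⟨C₀, hC₀⟩ := hAB A B
  obtain ⟨Γ, β₀, ℓ₀, c, Cc, -, -, hpos, -, -, -⟩ := hP
  have hev : ∀ᶠ β in atTop, m β / a β < c₁ := (tendsto_order.1 hlim).2 c₁ hc₁
  obtain ⟨β, hβge, hmlt⟩ := ((eventually_ge_atTop (max β₂ β₆)).and hev).exists
  have hma : m β < c₁ * a β := by rwa [div_lt_iff₀ (hpos β)] at hmlt
  have hδ : 0 < c₁ * a β - m β := by linarith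
  obtain ⟨Amp, hAmp, hS⟩ := hβ β (le_of_max_le_right hβge)
  have h1 : Tendsto (fun S : ℕ => (c₁ * a β - m β) * (S : ℝ)) atTop atTop :=
    Tendsto.const_mul_atTop hδ tendsto_natCast_atTop_atTop
  have h2 : Tendsto (fun S : ℕ => Real.exp (-((c₁ * a β - m β) * (S : ℝ)))) atTop (𝓝 0) :=
    Real.tendsto_exp_neg_atTop_nhds_zero.comp h1
  have h3 := h2.const_mul C₀
  rw [mul_zero] at h3
  have hev2 : ∀ᶠ S : ℕ in atTop, C₀ * Real.exp (-((c₁ * a β - m β) * (S : ℝ))) < Amp :=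
    (tendsto_order.1 h3).2 Amp hAmp
  obtain ⟨S₀, hS₀⟩ := Filter.eventually_atTop.1 (hev2.and (eventually_ge_atTop (S₁ β)))
  obtain ⟨S, hSge, hlowS⟩ := hS S₀
  obtain ⟨hsmall, hS₁⟩ := hS₀ S hSge
  have hup := hC₀ β (le_of_max_le_left hβge) S S hS₁ le_rfl
  have hchain : Amp * Real.exp (-(m β * S)) ≤ C₀ * Real.exp (-(c₁ * a β * S)) := hlowS.trans hup
  have hsplit : Real.exp (-(c₁ * a β * S)) =
      Real.exp (-((c₁ * a β - m β) * (S : ℝ))) * Real.exp (-(m β * S)) := by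
    rw [← Real.exp_add]
    congr 1
    ring
  rw [hsplit, ← mul_assoc] at hchain
  have hAmp_le : Amp ≤ C₀ * Real.exp (-((c₁ * a β - m β) * (S : ℝ))) :=
    le_of_mul_le_mul_right hchain (Real.exp_pos _)
  linarith

end Summit.QuantumFields.YangMills.Cruxes.LatticeGapInUVUnits.OneRuler

end
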